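/-
Copyright: the b2b-balaban T⁴-continuum CRUX team, row NE7b OWNER lineage `t4-ne7b-p1` (gen 117). Project licence.
-/
import Summits.QuantumFields.BalabanUV.T4Continuum.Spine.NE7b.SupTorusActionConvex

/-!
# THE CONVEXITY WINDOW IS TIGHT IN THE AVERAGING WEIGHT: on constant fields the torus form of `Δ^η + aQ′*Q′` is EXACTLY `a·Σ φ²`
# (the Laplacian does not see constants), so no floor of the torus form exceeds `a`; and if the sitewise curvature drops below
# `−a` on an interval (`u′ ≤ −(a + ε)` on `[t₁, t₂]`, `ε > 0`) the torus action VIOLATES the first-order letter of convexity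
# between the constant fields `t₁·1` and `t₂·1` — (92)'s window `λ < min(2,a)` cannot be widened past `a`: beyond it the
# constrained problem is a genuine large-field ∕ double-well problem, outside the convexity column
# (row NE7b, node U5c; (89) `torus_operator_apply` + TEA `fderiv_action_apply` BY NAME; [folklore])

Cell `pub-balaban`, sub-cell `t4`, spine estimate NE7b (`T4WeightBudget.RelWeightBound`; the cell's OWN estimate — NOT PRINTED in
[Bałaban 1983–89], NOT PROVED).  Crux-route work under `Spine/NE7b/` by the row OWNER (`t4-ne7b-p1` gen 117) under FREEZE (0)'s
crux-prover clause — an HONESTY file for the convexity column (89)–(96): where it stops; NOTHING of Bałaban's is named as a Lean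
object, valued or asserted; no `T4Continuum/Support` leaf typed; no `def`, no notation; zero `sorry`.  Imports (BY NAME): the OWNER's
(92) `…SupTorusActionConvex` (`mul_sub_mul_sub_ge`'s road; through it (89) `torus_operator_apply`, TDF `torus_operator_form_symm`, TEA
`fderiv_action_apply`), Mathlib (`antitoneOn_of_deriv_nonpos`, `exists_hasDerivAt_eq_slope`).

WHY (located).  (92)–(96) run on ONE letter, `u′ ≥ −λ` with `λ < min(2,a)`: the averaging term `aQ′*Q′` of `A` supplies curvature `a`
on the constants, which the Laplacian misses, and the constrained problem stays convex for potentials whose concavity is less than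
`a`.  This file records that the `a` in the window is not an artefact of B6QGQLower276's constant: (i) on a constant field the torus
form IS `a·Σ φ²`, so every floor `γ` of the form has `γ ≤ a`; (ii) if `u′ ≤ −(a + ε)` on an interval, then along the constant
fields `t·1` the action is `|𝕋|·(a t²∕2 + v(t))`, strictly concave there, and the first-order letter of (92) FAILS with explicit
witnesses.  Double-well potentials deeper than `a` are therefore outside the convexity column — they are the large-field problem the
node's `RelWeightBound` is about, which this column does not touch.

WHAT IS PROVED ([folklore]):
* §1 (one variable) `sub_sub_mul_le_of_deriv_le` (`u′ ≤ −c` on `[t₁, t₂]` ⟹ `v t₂ − v t₁ − u t₁·(t₂ − t₁) ≤ −c(t₂ − t₁)²∕2`, `v′ = u`: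
  the gap function is antitone).
* §2 (the `Beta.Site` carriers, displayed actions) **`torus_operator_const`** (`(Rf(A(Ef (t·1)))) x = a·t`: constants are in the kernel
  of the torus Laplacian), **`torus_form_const`** (`Σ_x (t·1)·At(t·1) = a·t²·|𝕋|`), **`torus_form_floor_le`** (ANY floor
  `γ·Σ φ² ≤ Σ φ·At φ` valid for all `φ` has `γ ≤ a`), `torus_action_const` (`S(t·1) = |𝕋|·(a t²∕2 + v t)`),
  `fderiv_torus_action_const` (`DS(t₁·1)((t₂ − t₁)·1) = |𝕋|·(a t₁ + u t₁)(t₂ − t₁)`).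
* §3 THE END **`torus_action_firstOrder_fails`**: `v′ = u`, `u′` exists, `0 < ε`, `t₁ < t₂`, `u′ ≤ −(a + ε)` on `[t₁, t₂]` ⟹
  `S(t₂·1) < S(t₁·1) + DS(t₁·1)((t₂ − t₁)·1)` — the first-order letter of convexity fails (by at least `½ε|𝕋|(t₂ − t₁)²`), every
  mesh, period, dimension.
* §4 toy.

HONEST (what this is NOT).  A tightness remark, not an estimate; it says nothing about what happens for such potentials (that is the
large-field analysis, NE7b proper, NOT PRINTED ∕ NOT PROVED); the `2` in `min(2,a)` (the block Poincaré part) is NOT shown sharp here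
(it is not: the true block floor is larger for `n ≥ 1`); nothing of Bałaban's.  BY-NAME EFFECT ON THE WALL: NONE.  NE7b NOT PRINTED ∕
NOT PROVED; spine PROVED 0∕9; rung (B)+1 on a FINITE torus — NOT infinite volume, NOT the mass gap, NOT Clay.  HONEST DEPENDENCY:
continuum YM on T⁴ ⇐ BetaPertH ∧ nine spine estimates (0∕9 proved); BetaPertH ⇐ (D1) ∧ (D4) ∧ CAP+tail; G-an2-4 gates asym, D1 and
NE2∕3∕4.
-/

set_option autoImplicit false

noncomputable section

namespace Summit.QuantumFields.BalabanUV.T4Continuum.NE7b.SupTorusActionConvexWindow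

open Set Function
open scoped ENNReal Topology
open Literature.MathematicalPhysics.QuantumFieldTheory.Balaban1983to89
open B6QGQLower276 (X e blk B side AX sum_B_const)
open B5Hk103ScalarZd (nbhd)
open Beta (Site siteOf windowMap)
open SupTorusDirichletForm (torus_operator_form_symm)
open SupTorusDirichletFormCoercive (torus_operator_apply)
open SupTorusEffectiveAction (fderiv_action_apply)

variable {d : ℕ}

/-! ## §1. One variable: a curvature ceiling is a secant ceiling -/

/-- **`u′ ≤ −c` ON `[t₁, t₂]` ⟹ `v t₂ − v t₁ − u t₁·(t₂ − t₁) ≤ −c(t₂ − t₁)²∕2`** (`v′ = u`, `u′` exists): the gap function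
`k t = v t − v t₁ − u t₁ (t − t₁) + c(t − t₁)²∕2` has `k′ t = u t − u t₁ + c(t − t₁) ≤ 0` on the interval (mean value theorem on `u`),
so `k t₂ ≤ k t₁ = 0`. [folklore] -/
theorem sub_sub_mul_le_of_deriv_le {v u u' : ℝ → ℝ} (hv : ∀ t, HasDerivAt v (u t) t) (hu : ∀ t, HasDerivAt u (u' t) t)
    {c t₁ t₂ : ℝ} (ht : t₁ ≤ t₂) (hu' : ∀ t ∈ Icc t₁ t₂, u' t ≤ -c) :
    v t₂ - v t₁ - u t₁ * (t₂ - t₁) ≤ -c * (t₂ - t₁) ^ 2 / 2 := by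
  -- `u t − u t₁ ≤ −c (t − t₁)` on the interval (mean value theorem)
  have hsec : ∀ t ∈ Icc t₁ t₂, u t - u t₁ ≤ -c * (t - t₁) := by
    intro t htI
    rcases eq_or_lt_of_le htI.1 with h | h
    · rw [← h]; simp
    · obtain ⟨ξ, hξ, hslope⟩ := exists_hasDerivAt_eq_slope u u' h
        (fun s _ => (hu s).continuousAt.continuousWithinAt) (fun s _ => hu s)
      have hξI : ξ ∈ Icc t₁ t₂ := ⟨hξ.1.le, hξ.2.le.trans htI.2⟩
      have hle := hu' ξ hξI
      rw [hslope, div_le_iff₀ (sub_pos.2 h)] at hle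
      linarith
  -- the gap function is antitone on `[t₁, t₂]`
  have hk : ∀ t, HasDerivAt (fun t => v t - v t₁ - u t₁ * (t - t₁) + c * (t - t₁) ^ 2 / 2)
      (u t - u t₁ + c * (t - t₁)) t := by
    intro t
    have h1 : HasDerivAt (fun t : ℝ => u t₁ * (t - t₁)) (u t₁ * 1) t := ((hasDerivAt_id t).sub_const t₁).const_mul _
    have h2 : HasDerivAt (fun t : ℝ => c * (t - t₁) ^ 2 / 2) (c * ((2 : ℕ) * (t - t₁) ^ (2 - 1) * 1) / 2) t :=
      ((((hasDerivAt_id t).sub_const t₁).pow 2).const_mul c).div_const 2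
    refine ((((hv t).sub_const (v t₁)).sub h1).add h2).congr_deriv ?_
    push_cast
    ring
  have hanti : AntitoneOn (fun t => v t - v t₁ - u t₁ * (t - t₁) + c * (t - t₁) ^ 2 / 2) (Icc t₁ t₂) := by
    refine antitoneOn_of_deriv_nonpos (convex_Icc t₁ t₂) (fun t _ => (hk t).continuousAt.continuousWithinAt)
      (fun t _ => (hk t).differentiableAt.differentiableWithinAt) fun t htI => ?_
    rw [interior_Icc] at htI
    rw [(hk t).deriv]
    have := hsec t ⟨htI.1.le, htI.2.le⟩
    linarith
  have h := hanti (left_mem_Icc.2 ht) (right_mem_Icc.2 ht) ht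
  simp only [sub_self, mul_zero, zero_pow two_ne_zero, zero_div, add_zero] at h
  linarith

/-! ## §2. The torus form and the action on constant fields -/

section Torus

variable (n : ℕ) (a : ℝ) (s : ℕ) [NeZero s]
  {Aop : lp (fun _ : X d => ℝ) ∞ →L[ℝ] lp (fun _ : X d => ℝ) ∞}
  (hA : ∀ (f : lp (fun _ : X d => ℝ) ∞) (p : X d), Aop f p = ∑ r ∈ nbhd n p, AX n a p r * f r)
  {Ef : (Site d ((n + 1) * s) → ℝ) →L[ℝ] lp (fun _ : X d => ℝ) ∞}
  (hEf : ∀ (g : Site d ((n + 1) * s) → ℝ) (q : X d), Ef g q = g (siteOf d ((n + 1) * s) q))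
  {Rf : lp (fun _ : X d => ℝ) ∞ →L[ℝ] (Site d ((n + 1) * s) → ℝ)}
  (hRf : ∀ (h : lp (fun _ : X d => ℝ) ∞) (x : Site d ((n + 1) * s)), Rf h x = h (windowMap d ((n + 1) * s) x))

include hA hEf hRf in
/-- **CONSTANTS ARE IN THE KERNEL OF THE TORUS LAPLACIAN**: `(Rf(A(Ef (t·1)))) x = a·t` at every fine torus site. [folklore] -/
theorem torus_operator_const (t : ℝ) (x : Site d ((n + 1) * s)) :
    ((Rf.comp Aop).comp Ef) (fun _ => t) x = a * t := by
  rw [ContinuousLinearMap.comp_apply, ContinuousLinearMap.comp_apply, torus_operator_apply n a s hA hEf hRf]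
  have hvol : (((n : ℝ) + 1) ^ d) ≠ 0 := by positivity
  simp only [two_mul, add_sub_cancel_right, sub_self, Finset.sum_const_zero, mul_zero, zero_add]
  rw [sum_B_const]
  field_simp

include hA hEf hRf in
/-- **THE TORUS FORM ON A CONSTANT FIELD IS `a·t²·|𝕋|`.** [folklore] -/
theorem torus_form_const (t : ℝ) :
    ∑ x : Site d ((n + 1) * s), (fun _ : Site d ((n + 1) * s) => t) x * ((Rf.comp Aop).comp Ef) (fun _ => t) x
      = a * t ^ 2 * Fintype.card (Site d ((n + 1) * s)) := by
  simp only [torus_operator_const n a s hA hEf hRf, Finset.sum_const, Finset.card_univ, nsmul_eq_mul]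
  ring

include hA hEf hRf in
/-- **NO FLOOR OF THE TORUS FORM EXCEEDS THE AVERAGING WEIGHT**: if `γ·Σ_x φ² ≤ Σ_x φ·At φ` for every fine torus field, then `γ ≤ a`
(test on the constant field `1`). [folklore] -/
theorem torus_form_floor_le {γ : ℝ}
    (hγ : ∀ φ : Site d ((n + 1) * s) → ℝ, γ * ∑ x, φ x ^ 2 ≤ ∑ x, φ x * ((Rf.comp Aop).comp Ef) φ x) : γ ≤ a := by
  have h := hγ (fun _ => 1)
  rw [torus_form_const n a s hA hEf hRf 1] at h
  simp only [one_pow, Finset.sum_const, Finset.card_univ, nsmul_eq_mul, mul_one] at h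
  have hcard : (0 : ℝ) < Fintype.card (Site d ((n + 1) * s)) := by
    exact_mod_cast Fintype.card_pos_iff.2 ⟨fun _ => 0⟩
  nlinarith

include hA hEf hRf in
/-- **THE ACTION ON A CONSTANT FIELD**: `S(t·1) = |𝕋|·(a t²∕2 + v t)`. [folklore] -/
theorem torus_action_const (v : ℝ → ℝ) (t : ℝ) :
    (1 / 2 : ℝ) * ∑ x : Site d ((n + 1) * s), (fun _ : Site d ((n + 1) * s) => t) x * ((Rf.comp Aop).comp Ef) (fun _ => t) x
        + ∑ x : Site d ((n + 1) * s), v ((fun _ : Site d ((n + 1) * s) => t) x)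
      = (Fintype.card (Site d ((n + 1) * s)) : ℝ) * (a * t ^ 2 / 2 + v t) := by
  rw [torus_form_const n a s hA hEf hRf t]
  simp only [Finset.sum_const, Finset.card_univ, nsmul_eq_mul]
  ring

include hA hEf hRf in
/-- **THE DIFFERENTIAL OF THE ACTION BETWEEN CONSTANT FIELDS**: `DS(t₁·1)((t₂·1) − (t₁·1)) = |𝕋|·(a t₁ + u t₁)·(t₂ − t₁)`. [folklore] -/
theorem fderiv_torus_action_const {v u : ℝ → ℝ} (hv : ∀ t, HasDerivAt v (u t) t) (t₁ t₂ : ℝ) :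
    fderiv ℝ (fun φ : Site d ((n + 1) * s) → ℝ => (1 / 2 : ℝ) * ∑ x, φ x * ((Rf.comp Aop).comp Ef) φ x + ∑ x, v (φ x))
        (fun _ => t₁) ((fun _ : Site d ((n + 1) * s) => t₂) - fun _ => t₁)
      = (Fintype.card (Site d ((n + 1) * s)) : ℝ) * ((a * t₁ + u t₁) * (t₂ - t₁)) := by
  rw [fderiv_action_apply ((Rf.comp Aop).comp Ef) (torus_operator_form_symm n a s hA hEf hRf) hv]
  simp only [torus_operator_const n a s hA hEf hRf, Pi.sub_apply, Finset.sum_const, Finset.card_univ, nsmul_eq_mul]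

/-! ## §3. THE END: below `−a` the first-order letter of convexity fails -/

include hA hEf hRf in
/-- **THE CONVEXITY WINDOW IS TIGHT IN `a`**: `v′ = u`, `u′` exists, `ε > 0`, `t₁ < t₂` and `u′ t ≤ −(a + ε)` on `[t₁, t₂]` ⟹ between
the constant torus fields `φ = t₁·1` and `ψ = t₂·1` the first-order letter FAILS:
`S ψ + ½ε·|𝕋|·(t₂ − t₁)² ≤ S φ + DS(φ)(ψ − φ)`, in particular `S ψ < S φ + DS(φ)(ψ − φ)` — the torus action is not convex, at any mesh,
period or dimension; (92)'s window cannot be widened past `a`. [folklore] -/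
theorem torus_action_firstOrder_fails {v u u' : ℝ → ℝ} (hv : ∀ t, HasDerivAt v (u t) t) (hu : ∀ t, HasDerivAt u (u' t) t)
    {ε t₁ t₂ : ℝ} (hε : 0 < ε) (ht : t₁ < t₂) (hu' : ∀ t ∈ Icc t₁ t₂, u' t ≤ -(a + ε)) :
    ((1 / 2 : ℝ) * ∑ x : Site d ((n + 1) * s),
          (fun _ : Site d ((n + 1) * s) => t₂) x * ((Rf.comp Aop).comp Ef) (fun _ => t₂) x
        + ∑ x : Site d ((n + 1) * s), v ((fun _ : Site d ((n + 1) * s) => t₂) x))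
        + ε / 2 * (Fintype.card (Site d ((n + 1) * s)) : ℝ) * (t₂ - t₁) ^ 2
      ≤ ((1 / 2 : ℝ) * ∑ x : Site d ((n + 1) * s),
            (fun _ : Site d ((n + 1) * s) => t₁) x * ((Rf.comp Aop).comp Ef) (fun _ => t₁) x
          + ∑ x : Site d ((n + 1) * s), v ((fun _ : Site d ((n + 1) * s) => t₁) x))
        + fderiv ℝ (fun φ : Site d ((n + 1) * s) → ℝ =>
            (1 / 2 : ℝ) * ∑ x, φ x * ((Rf.comp Aop).comp Ef) φ x + ∑ x, v (φ x))
          (fun _ => t₁) ((fun _ : Site d ((n + 1) * s) => t₂) - fun _ => t₁) ∧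
    ((1 / 2 : ℝ) * ∑ x : Site d ((n + 1) * s),
          (fun _ : Site d ((n + 1) * s) => t₂) x * ((Rf.comp Aop).comp Ef) (fun _ => t₂) x
        + ∑ x : Site d ((n + 1) * s), v ((fun _ : Site d ((n + 1) * s) => t₂) x))
      < ((1 / 2 : ℝ) * ∑ x : Site d ((n + 1) * s),
            (fun _ : Site d ((n + 1) * s) => t₁) x * ((Rf.comp Aop).comp Ef) (fun _ => t₁) x
          + ∑ x : Site d ((n + 1) * s), v ((fun _ : Site d ((n + 1) * s) => t₁) x))
        + fderiv ℝ (fun φ : Site d ((n + 1) * s) → ℝ =>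
            (1 / 2 : ℝ) * ∑ x, φ x * ((Rf.comp Aop).comp Ef) φ x + ∑ x, v (φ x))
          (fun _ => t₁) ((fun _ : Site d ((n + 1) * s) => t₂) - fun _ => t₁) := by
  rw [torus_action_const n a s hA hEf hRf v t₂, torus_action_const n a s hA hEf hRf v t₁,
    fderiv_torus_action_const n a s hA hEf hRf hv t₁ t₂]
  have hcard : (0 : ℝ) < Fintype.card (Site d ((n + 1) * s)) := by
    exact_mod_cast Fintype.card_pos_iff.2 ⟨fun _ => 0⟩
  have hgap := sub_sub_mul_le_of_deriv_le hv hu ht.le hu'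
  -- per site: `a t₂²∕2 + v t₂ + ε(t₂−t₁)²∕2 ≤ a t₁²∕2 + v t₁ + (a t₁ + u t₁)(t₂ − t₁)`
  have hsite : a * t₂ ^ 2 / 2 + v t₂ + ε / 2 * (t₂ - t₁) ^ 2 ≤ a * t₁ ^ 2 / 2 + v t₁ + (a * t₁ + u t₁) * (t₂ - t₁) := by
    nlinarith [hgap]
  have hpos : 0 < ε / 2 * (Fintype.card (Site d ((n + 1) * s)) : ℝ) * (t₂ - t₁) ^ 2 := by
    have : 0 < (t₂ - t₁) ^ 2 := by nlinarith [sub_pos.2 ht]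
    positivity
  constructor
  · nlinarith [mul_le_mul_of_nonneg_left hsite hcard.le]
  · nlinarith [mul_le_mul_of_nonneg_left hsite hcard.le]

end Torus

/-! ## §4. Toy -/

/-- Toy (§1): `v t = −t²`, `u t = −2t`, `u′ = −2 ≤ −2` on `[0, 1]`: `v 1 − v 0 − u 0·1 ≤ −2·1²∕2`. -/
example : (fun t : ℝ => -t ^ 2) 1 - (fun t : ℝ => -t ^ 2) 0 - (fun t : ℝ => -2 * t) 0 * (1 - 0) ≤ -(2 : ℝ) * (1 - 0) ^ 2 / 2 := by
  have hv : ∀ t : ℝ, HasDerivAt (fun t : ℝ => -t ^ 2) (-2 * t) t := fun t => by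
    have h := (hasDerivAt_pow 2 t).const_mul (-1 : ℝ)
    simp only [Nat.cast_ofNat, Nat.add_one_sub_one, pow_one, neg_mul, one_mul] at h
    exact h.congr_deriv (by ring)
  have hu : ∀ t : ℝ, HasDerivAt (fun t : ℝ => -2 * t) (-2 : ℝ) t := fun t => by
    simpa using (hasDerivAt_id t).const_mul (-2 : ℝ)
  exact sub_sub_mul_le_of_deriv_le hv hu (c := 2) zero_le_one (fun t _ => by norm_num)

end Summit.QuantumFields.BalabanUV.T4Continuum.NE7b.SupTorusActionConvexWindow

end
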